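import Mathlib
import Summits.Ventures.PercRepro2.WeightedRowInactive
import Summits.Ventures.PercRepro2.TwoCopyBHK
import Summits.Ventures.PercRepro2.Events
import Summits.Ventures.PercRepro2.AvoidMono

/-!
# «Mixed BHK» is mine-1's two-copy BHK (line-convexity) conjecture, in the tree under `CrossBase`
(blind cell PercRepro2, night-3 g20, 2026-08-28; `proofs/NIGHT3-CERT.md` §29)

The candidate `CovForm.MixedBHK` of `WeightedRowInactive.lean` (the cross-cluster inequality for
the exchangeable pair coupling with exactly one complementary edge) is, term by term, mine-1's
two-copy BHK / line-convexity conjecture (MINE-1.md §19.7), which p1's `twoCopyBHK_of_crossBase`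
(`TwoCopyBHK.lean`) derives from `CrossBase` — the weighted form of the typed two-copy row (BASE).
So (`mixedBHK_of_crossBase`) `CrossBase` in both orientations gives `MixedBHK`, and hence
(`wrow23_of_a3Inactive_of_crossBase`) the weighted row (W-ROW-23) on every `a₃`-inactive instance
follows from the cell's two-copy hypothesis chain — the exact weighted twin of g19's typed
`row23_of_inactive` (from `CrossCount`). Own work; standard axioms.
-/

namespace Summit.Ventures.PercRepro2

open UnionCluster

namespace CovForm

section OfCrossBase

variable {V : Type*} {E : Type*} [Fintype E] [DecidableEq E] [Fintype V] [DecidableEq V]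
  {R : Type*} [Field R] [LinearOrder R] [IsStrictOrderedRing R]

omit [Fintype V] [DecidableEq V] [Fintype E] [DecidableEq E] [LinearOrder R] [IsStrictOrderedRing R] in
/-- `Q = {a₁ ↮ a₂}` as the complement of the connection event. -/
lemma avoidAll_eq_compl_conn (ends : E → Sym2 V) (a₁ a₂ : V) :
    avoidAll ends a₂ {a₁} = (connEvent ends a₁ a₂)ᶜ := by
  rw [AvoidMono.avoid_singleton_eq_compl, connEvent_comm]

omit [Fintype V] [DecidableEq V] in
/-- **`MixedBHK` from `CrossBase` in both orientations** (p1's `twoCopyBHK_of_crossBase` at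
`p[e := ½]`, the pinned laws being those of `p`). -/
theorem mixedBHK_of_crossBase (ends : E → Sym2 V) (o a₁ a₂ b : V)
    (h₁ : CrossBase R ends a₁ a₂ b o) (h₂ : CrossBase R ends a₂ a₁ b o) :
    MixedBHK (R := R) ends o a₁ a₂ b := by
  intro p hp e
  have hp' : ∀ f, 0 ≤ Function.update p e (1 / 2 : R) f ∧ Function.update p e (1 / 2 : R) f ≤ 1 := by
    intro f
    by_cases hf : f = e
    · subst hf; simp; norm_num
    · rw [Function.update_of_ne hf]; exact ⟨hp.nonneg f, hp.le_one f⟩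
  have hlt0 : (0 : R) < Function.update p e (1 / 2 : R) e := by simp
  have hlt1 : Function.update p e (1 / 2 : R) e < 1 := by simp; norm_num
  have k₁ := twoCopyBHK_of_crossBase h₁ _ hp' e hlt0 hlt1
  have k₂ := twoCopyBHK_of_crossBase h₂ _ hp' e hlt0 hlt1
  simp only [Function.update_idem] at k₁ k₂
  rw [connEvent_comm ends a₂ a₁] at k₂
  rw [avoidAll_eq_compl_conn]
  have e1 : ∀ q : E → R, prob q ((connEvent ends a₁ a₂)ᶜ ∩ (connEvent ends a₂ o ∩ connEvent ends a₁ b)) =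
      prob q ((connEvent ends a₁ a₂)ᶜ ∩ connEvent ends a₁ b ∩ connEvent ends a₂ o) := by
    intro q; congr 1; ext ω; simp only [Set.mem_inter_iff]; tauto
  have e2 : ∀ q : E → R, prob q ((connEvent ends a₁ a₂)ᶜ ∩ (connEvent ends a₁ o ∩ connEvent ends a₂ b)) =
      prob q ((connEvent ends a₁ a₂)ᶜ ∩ connEvent ends a₂ b ∩ connEvent ends a₁ o) := by
    intro q; congr 1; ext ω; simp only [Set.mem_inter_iff]; tauto
  rw [e1, e1, e2, e2]
  linear_combination k₁ + k₂

/-- **(W-ROW-23) on `a₃`-inactive instances from `CrossBase`** (both orientations): the weighted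
twin of g19's typed `row23_of_inactive`. -/
theorem wrow23_of_a3Inactive_of_crossBase (ends : E → Sym2 V) (o a₁ a₂ a₃ b : V)
    (h₁ : CrossBase R ends a₁ a₂ b o) (h₂ : CrossBase R ends a₂ a₁ b o)
    (h : ∀ ω : Config E, ¬ Conn ends ω a₁ a₃ ∧ ¬ Conn ends ω a₂ a₃)
    (p : E → R) (hp : IsProbVec p) (e : E) (τ : E → ℕ) (hτ : τ e = 2) :
    p e ^ 2 * (1 - p e) * Gc (Function.update p e 1) ends o a₁ a₂ a₃ b ≤
      triSum p {e} τ (K3 ends o a₁ a₂ a₃ b) :=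
  wrow23_of_a3Inactive_of_mixedBHK ends o a₁ a₂ a₃ b (mixedBHK_of_crossBase ends o a₁ a₂ b h₁ h₂)
    h p hp e τ hτ

end OfCrossBase

end CovForm

end Summit.Ventures.PercRepro2
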